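import Literature.Probability.LatticeModels.LeeYangFirstZeroMonotone
import Literature.Probability.LatticeModels.UrsellMonotonicity
import Literature.Probability.LatticeModels.IsingLimitLawLeeYangProofs
import HarnessLib

/-!
# Camia–Jiang–Newman 2023, Theorem 2 ⇒ the route form `firstZero_antitone` (proofs)

Topic `Literature/Probability/LatticeModels`; sibling PROOF file of `LeeYangFirstZeroMonotone.lean`
(named fact `CamiaJiangNewman.firstZero_antitone`: the first real zero of
`θ ↦ ⟨cos(θ ∑_{u∈B} λ_u σ_u)⟩^{free}_{Λ;β,0}` is antitone in `β`). We prove, sorry-free and from the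
tree,

* `CamiaJiangNewman.firstZero_antitone_of_thm2 : CamiaJiangNewman2023_thm2 → firstZero_antitone`,

i.e. the reduction of the route form to the tree's named fact of `UrsellMonotonicity.lean`
(CJN 2023 Thm 2 in ZERO FORM over `PairIsing.mgf`); with the tree's
`CamiaJiangNewman2023_thm2_of_thm1` (`UrsellFirstZeroProofs.lean`, the printed proof of Thm 2 from
Thm 1) it reduces further to CJN Thm 1 (`CamiaJiangNewman2023_thm1`, the monotonicity of Ursell
functions). This is exactly the printed deduction of Camia–Jiang–Newman 2023, §1.2 (proof of
Thm 2, arXiv p. 4) read in the free box: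

1. **Generalised Lee–Yang** ("A generalization of the Lee–Yang result (see, e.g., Theorem 1 of
   [New75] or Lemma 4.2 of [NG83]) states that all zeros of `⟨exp[h∑λ_uσ_u]⟩_{G,J}` are pure
   imaginary"): `PairIsing.mgf_ne_zero_of_re_ne_zero` — for couplings `c ≥ 0` and weights `λ ≥ 0`
   (zero weights allowed) every zero of `h ↦ ⟨e^{hX}⟩_c`, `X = Σ λ_u σ_u`, has `Re h = 0`. It is the
   tree's `lee_yang_circle_theorem_finite_of_nonneg` (`IsingLimitLawLeeYangProofs.lean`: Lee–Yang
   1952 App. II by Asano contractions, boundary fields `h_u = 0` by the maximum modulus principle)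
   transported from `Fin n → Bool` to the configurations `ι → ℤˣ` of `PairIsing`
   (`leeYang_bool_of_nonneg`, `sum_exp_weight_ne_zero`).
2. **Parity**: `PairIsing.mgf_neg` (`⟨e^{-hX}⟩ = ⟨e^{hX}⟩`, spin flip) and `PairIsing.mgf_mul_I`
   (`⟨e^{iθX}⟩ = ⟨cos θX⟩`), so the real zeros of `θ ↦ ⟨cos θX⟩` are exactly the (moduli of the)
   zeros of the mgf.
3. **Dictionary**: the free-boundary zero-field box `⟨·⟩^{free}_{Λ;β,0}` of the tree IS the
   pair-interaction average with couplings `β/2·𝟙{a ∼ b}` on `↥Λ` (a private copy of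
   `PairIsing.avg_adj_eq_isingExpect_free` of `TwistCorr.lean`, kept out of this file's imports),
   and `β ≤ β'` gives `c ≤ c'` entrywise (`isingExpect_cos_eq_avg`).
4. **Assembly** (`firstZero_antitone_of_thm2`): a zero `θ > 0` of `⟨cos θX⟩_β` is the zero `iθ` of
   `mgf_c`; Thm 2 (zero form) gives a zero `h'` of `mgf_{c'}` with `‖h'‖ ≤ θ`; by (1) `h' = ±iθ'`,
   `θ' = |Im h'| > 0` (`mgf(0) = 1`), and by (2) `⟨cos θ'X⟩_{β'} = 0` with `θ' ≤ θ`.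

No definitions, no named facts. The discharge `firstZero_antitone_holds` is then the one-liner
`firstZero_antitone_of_thm2 (CamiaJiangNewman2023_thm2_of_thm1 CamiaJiangNewman2023_thm1_holds)`
once CJN Thm 1 is proved in the tree (it is not, as of this file).

## References

* [CamiaJiangNewman2023] F. Camia, J. Jiang, C. M. Newman, *Monotonicity of Ursell functions in the
  Ising model*, CMP 401 (2023) 2459–2482, arXiv:2207.12247: Thm 2, Cor 1 and the proof of Thm 2
  (§1.2, p. 4, eqs. (10)–(14)).
* [Newman1975] C. M. Newman, CMP 41 (1975) 1–9, Thm 1; [LeeYang1952] App. II;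
  [LiebSokal1981] §3 (zero weights).
* [FriedliVelenik2017] §3.1 eq. (3.8) (the free box).
-/

noncomputable section

open Finset Complex MeasureTheory

namespace Literature.Probability.LatticeModels

/-! ### 1. The generalised Lee–Yang theorem for `PairIsing.mgf` -/

section LeeYangBool

variable {ι : Type*} [Fintype ι] [DecidableEq ι]

/-- Lee–Yang with non-negative fields, some of them zero, over an arbitrary finite index type
(transport of `lee_yang_circle_theorem_finite_of_nonneg` along `ι ≃ Fin n`).
[cite: LeeYang1952, Appendix II] [cite: LiebSokal1981, §3, Cor. 3.3] -/
theorem leeYang_bool_of_nonneg (J : ι → ι → ℝ) (h : ι → ℂ) (hJ : ∀ a b, 0 ≤ J a b)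
    (hh : ∀ a, 0 < (h a).re ∨ h a = 0) :
    (∑ σ : ι → Bool, exp ((∑ a, ∑ b, ((J a b : ℂ) * (if σ a = σ b then 1 else -1))) +
      ∑ a, h a * (if σ a then 1 else -1))) ≠ 0 := by
  classical
  set n := Fintype.card ι with hn
  set e : ι ≃ Fin n := Fintype.equivFin ι with he
  have key := lee_yang_circle_theorem_finite_of_nonneg (n := n)
    (fun i j => J (e.symm i) (e.symm j)) (fun i => h (e.symm i))
    (fun i j => hJ _ _) (fun i => hh _)
  -- reindex configurations `σ' : Fin n → Bool` as `σ' ∘ e`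
  have hsum : (∑ σ : ι → Bool, exp ((∑ a, ∑ b, ((J a b : ℂ) * (if σ a = σ b then 1 else -1))) +
      ∑ a, h a * (if σ a then 1 else -1))) =
      ∑ σ' : Fin n → Bool, exp ((∑ i, ∑ j,
        (((J (e.symm i) (e.symm j) : ℝ) : ℂ) * (if σ' i = σ' j then 1 else -1))) +
          ∑ i, h (e.symm i) * (if σ' i then 1 else -1)) := by
    refine Fintype.sum_equiv (e.arrowCongr (Equiv.refl Bool)) _ _ fun σ => ?_
    have happ : ∀ i, (e.arrowCongr (Equiv.refl Bool)) σ i = σ (e.symm i) := fun i => rfl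
    simp_rw [happ]
    congr 2
    · exact Fintype.sum_equiv e _ _ fun a => Fintype.sum_equiv e _ _ fun b => by
        simp only [Equiv.symm_apply_apply]
    · exact Fintype.sum_equiv e _ _ fun a => by simp only [Equiv.symm_apply_apply]
  rw [hsum]
  exact key

end LeeYangBool

namespace PairIsing

variable {ι : Type*} [Fintype ι] [DecidableEq ι]

omit [DecidableEq ι] in
/-- Spin flip leaves the Boltzmann weight invariant (local copy of `PairIsing.weight_neg` of
`UrsellFirstZeroProofs.lean`, kept out of this file's imports). [folklore] -/
private theorem weight_neg' (c : ι → ι → ℝ) (ρ : SpinConfig ι) : weight c (-ρ) = weight c ρ := by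
  unfold weight
  simp [spinAt_neg]

omit [DecidableEq ι] in
/-- Spin flip reverses the weighted magnetisation (local copy, as above). [folklore] -/
private theorem weightedMagnetization_neg' (lam : ι → ℝ) (ρ : SpinConfig ι) :
    weightedMagnetization lam (-ρ) = -weightedMagnetization lam ρ := by
  unfold weightedMagnetization
  simp [spinAt_neg, sum_neg_distrib]

/-- The numerator of the mgf, `Σ_ρ e^{hX(ρ)} w_c(ρ)`, does not vanish for `c ≥ 0`, `λ ≥ 0`,
`Re h > 0`: the Lee–Yang sum of `leeYang_bool_of_nonneg` with `J = c` and fields `h λ_u`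
(`Re (hλ_u) > 0` if `λ_u > 0`, `= 0` if `λ_u = 0`), configurations `ι → ℤˣ` coded by Booleans.
[cite: CamiaJiangNewman2023, §1.2 (proof of Thm 2: "all zeros … are pure imaginary")]
[cite: Newman1975, Thm 1] -/
theorem sum_exp_weight_ne_zero {c : ι → ι → ℝ} (hc : ∀ a b, 0 ≤ c a b) {lam : ι → ℝ}
    (hlam : ∀ a, 0 ≤ lam a) {h : ℂ} (hh : 0 < h.re) :
    (∑ ρ : SpinConfig ι, exp (h * (weightedMagnetization lam ρ : ℂ)) * (weight c ρ : ℂ)) ≠ 0 := by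
  classical
  -- fields
  set hf : ι → ℂ := fun a => h * (lam a : ℂ) with hhf
  have hfield : ∀ a, 0 < (hf a).re ∨ hf a = 0 := by
    intro a
    rcases (hlam a).lt_or_eq with hpos | hzero
    · left
      rw [hhf]
      simp only [mul_re, ofReal_re, ofReal_im, mul_zero, sub_zero]
      exact mul_pos hh hpos
    · right
      rw [hhf]
      simp [← hzero]
  have hLY := leeYang_bool_of_nonneg c hf hc hfield
  -- configurations coded by Booleans
  set Φ : SpinConfig ι ≃ (ι → Bool) :=
    { toFun := fun τ a => decide (τ a = 1)
      invFun := fun σ a => if σ a then 1 else -1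
      left_inv := fun τ => funext fun a => by
        rcases Int.units_eq_one_or (τ a) with h1 | h1 <;> simp [h1]
      right_inv := fun σ => funext fun a => by
        dsimp only
        rcases Bool.eq_false_or_eq_true (σ a) with h1 | h1 <;> simp [h1] } with hΦ
  have hΦapp : ∀ τ a, Φ τ a = decide (τ a = 1) := fun τ a => rfl
  have key : (∑ ρ : SpinConfig ι, exp (h * (weightedMagnetization lam ρ : ℂ)) * (weight c ρ : ℂ)) =
      ∑ σ : ι → Bool, exp ((∑ a, ∑ b, ((c a b : ℂ) * (if σ a = σ b then 1 else -1))) +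
        ∑ a, hf a * (if σ a then 1 else -1)) := by
    refine Fintype.sum_equiv Φ _ _ fun τ => ?_
    have hQ : ∀ a, (if Φ τ a then (1 : ℂ) else -1) = (spinAt a τ : ℂ) := fun a => by
      rw [hΦapp, spinAt]
      rcases Int.units_eq_one_or (τ a) with h1 | h1 <;> simp [h1]
    have hP : ∀ a b, (if Φ τ a = Φ τ b then (1 : ℂ) else -1) =
        (spinAt a τ : ℂ) * (spinAt b τ : ℂ) := by
      intro a b
      rw [hΦapp, hΦapp, spinAt, spinAt]
      rcases Int.units_eq_one_or (τ a) with h1 | h1 <;>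
        rcases Int.units_eq_one_or (τ b) with h2 | h2 <;> simp [h1, h2]
    simp_rw [hP, hQ]
    have hexp : h * (weightedMagnetization lam τ : ℂ) +
        ((∑ a, ∑ b, c a b * (spinAt a τ * spinAt b τ) : ℝ) : ℂ) =
        (∑ a, ∑ b, (c a b : ℂ) * ((spinAt a τ : ℂ) * (spinAt b τ : ℂ))) +
          ∑ a, hf a * (spinAt a τ : ℂ) := by
      rw [add_comm]
      push_cast
      congr 1
      unfold weightedMagnetization
      push_cast
      rw [mul_sum]
      refine sum_congr rfl fun a _ => ?_
      simp only [hhf]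
      ring
    rw [weight, ofReal_exp, ← exp_add, hexp]
  rw [key]
  exact hLY

/-- **Generalised Lee–Yang theorem, right half plane**: for `c ≥ 0`, `λ ≥ 0` and `Re h > 0`,
`⟨e^{hX}⟩_c ≠ 0`. [cite: Newman1975, Thm 1] [cite: LeeYang1952, Appendix II] -/
theorem mgf_ne_zero_of_re_pos {c : ι → ι → ℝ} (hc : ∀ a b, 0 ≤ c a b) {lam : ι → ℝ}
    (hlam : ∀ a, 0 ≤ lam a) {h : ℂ} (hh : 0 < h.re) : mgf c lam h ≠ 0 := by
  rw [mgf]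
  exact div_ne_zero (sum_exp_weight_ne_zero hc hlam hh)
    (ofReal_ne_zero.2 (sum_weight_pos c).ne')

/-- **Spin flip**: `⟨e^{-hX}⟩_c = ⟨e^{hX}⟩_c`. [cite: CamiaJiangNewman2023, §1.1 eq. (5)] -/
theorem mgf_neg (c : ι → ι → ℝ) (lam : ι → ℝ) (h : ℂ) : mgf c lam (-h) = mgf c lam h := by
  unfold mgf
  congr 1
  calc ∑ ρ : SpinConfig ι, exp (-h * (weightedMagnetization lam ρ : ℂ)) * (weight c ρ : ℂ)
      = ∑ ρ : SpinConfig ι, exp (h * (weightedMagnetization lam (-ρ) : ℂ)) *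
          (weight c (-ρ) : ℂ) := by
        refine sum_congr rfl fun ρ _ => ?_
        rw [weight_neg', weightedMagnetization_neg']
        push_cast
        ring_nf
    _ = ∑ ρ : SpinConfig ι, exp (h * (weightedMagnetization lam ρ : ℂ)) * (weight c ρ : ℂ) :=
        Fintype.sum_equiv (Equiv.neg (SpinConfig ι)) _ _ fun ρ => rfl

/-- **Generalised Lee–Yang theorem** ("all zeros of `⟨exp[h∑_{u∈V}λ_uσ_u]⟩_{G,J}` are pure
imaginary", CJN proof of Thm 2; Newman 1975 Thm 1; Nishimori–Griffiths 1983 Lemma 4.2): for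
`c ≥ 0` and `λ ≥ 0`, `⟨e^{hX}⟩_c ≠ 0` whenever `Re h ≠ 0`.
[cite: CamiaJiangNewman2023, §1.2 (proof of Thm 2)] [cite: Newman1975, Thm 1] -/
theorem mgf_ne_zero_of_re_ne_zero {c : ι → ι → ℝ} (hc : ∀ a b, 0 ≤ c a b) {lam : ι → ℝ}
    (hlam : ∀ a, 0 ≤ lam a) {h : ℂ} (hh : h.re ≠ 0) : mgf c lam h ≠ 0 := by
  rcases lt_or_gt_of_ne hh with hlt | hgt
  · rw [← mgf_neg]
    exact mgf_ne_zero_of_re_pos hc hlam (by rw [neg_re]; linarith)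
  · exact mgf_ne_zero_of_re_pos hc hlam hgt

/-- Zeros of the mgf are purely imaginary. [cite: CamiaJiangNewman2023, §1.2 (proof of Thm 2)] -/
theorem re_eq_zero_of_mgf_eq_zero {c : ι → ι → ℝ} (hc : ∀ a b, 0 ≤ c a b) {lam : ι → ℝ}
    (hlam : ∀ a, 0 ≤ lam a) {h : ℂ} (hz : mgf c lam h = 0) : h.re = 0 := by
  by_contra hre
  exact mgf_ne_zero_of_re_ne_zero hc hlam hre hz

/-! ### 2. Parity: `⟨e^{iθX}⟩ = ⟨cos θX⟩` -/

/-- The mgf is the average of `cosh(hX)` (spin flip). [cite: CamiaJiangNewman2023, §1.1 eq. (5)] -/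
theorem mgf_eq_sum_cosh (c : ι → ι → ℝ) (lam : ι → ℝ) (h : ℂ) :
    mgf c lam h = (∑ ρ : SpinConfig ι, cosh (h * (weightedMagnetization lam ρ : ℂ)) *
      (weight c ρ : ℂ)) / ((∑ ρ : SpinConfig ι, weight c ρ : ℝ) : ℂ) := by
  have h2 : (2 : ℂ) * mgf c lam h = mgf c lam h + mgf c lam (-h) := by rw [mgf_neg]; ring
  have h3 : mgf c lam h + mgf c lam (-h) = (∑ ρ : SpinConfig ι,
      2 * cosh (h * (weightedMagnetization lam ρ : ℂ)) * (weight c ρ : ℂ)) /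
        ((∑ ρ : SpinConfig ι, weight c ρ : ℝ) : ℂ) := by
    unfold mgf
    rw [← add_div, ← sum_add_distrib]
    congr 1
    refine sum_congr rfl fun ρ _ => ?_
    rw [two_cosh, neg_mul]
    ring
  have h4 : (∑ ρ : SpinConfig ι, 2 * cosh (h * (weightedMagnetization lam ρ : ℂ)) * (weight c ρ : ℂ)) =
      2 * ∑ ρ : SpinConfig ι, cosh (h * (weightedMagnetization lam ρ : ℂ)) * (weight c ρ : ℂ) := by
    rw [mul_sum]
    refine sum_congr rfl fun ρ _ => ?_
    ring
  rw [h3, h4, mul_div_assoc] at h2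
  exact mul_left_cancel₀ two_ne_zero h2

/-- **`⟨e^{iθX}⟩_c = ⟨cos(θX)⟩_c`** for real `θ`: on the imaginary axis the mgf is the (real) Gibbs
average of `cos(θX)`. [cite: CamiaJiangNewman2023, §1.2] -/
theorem mgf_mul_I (c : ι → ι → ℝ) (lam : ι → ℝ) (θ : ℝ) :
    mgf c lam (θ * I) =
      ((avg c (fun ρ => Real.cos (θ * weightedMagnetization lam ρ)) : ℝ) : ℂ) := by
  rw [mgf_eq_sum_cosh, avg_def]
  push_cast
  congr 1
  refine sum_congr rfl fun ρ _ => ?_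
  congr 1
  rw [← cosh_mul_I]
  congr 1
  ring

/-- A zero of the mgf is `± iθ'` with `θ' = |Im h| > 0` a real zero of `⟨cos θ'X⟩`, `θ' ≤ ‖h‖`.
[cite: CamiaJiangNewman2023, §1.2 (proof of Thm 2)] -/
theorem exists_cos_zero_of_mgf_eq_zero {c : ι → ι → ℝ} (hc : ∀ a b, 0 ≤ c a b) {lam : ι → ℝ}
    (hlam : ∀ a, 0 ≤ lam a) {h : ℂ} (hz : mgf c lam h = 0) :
    ∃ θ' : ℝ, 0 < θ' ∧ θ' ≤ ‖h‖ ∧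
      avg c (fun ρ => Real.cos (θ' * weightedMagnetization lam ρ)) = 0 := by
  have hre : h.re = 0 := re_eq_zero_of_mgf_eq_zero hc hlam hz
  have hne : h ≠ 0 := by
    rintro rfl
    rw [mgf_zero] at hz
    exact one_ne_zero hz
  have him : h.im ≠ 0 := by
    intro him
    exact hne (Complex.ext (by simp [hre]) (by simp [him]))
  refine ⟨|h.im|, abs_pos.2 him, abs_im_le_norm h, ?_⟩
  have hh : h = (h.im : ℂ) * I := Complex.ext (by simp [hre]) (by simp)
  rcases le_or_gt 0 h.im with hpos | hneg
  · rw [abs_of_nonneg hpos]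
    have := mgf_mul_I c lam h.im
    rw [← hh, hz] at this
    exact_mod_cast this.symm
  · rw [abs_of_neg hneg]
    have hh2 : ((-h.im : ℝ) : ℂ) * I = -h := by
      conv_rhs => rw [hh]
      push_cast
      ring
    have := mgf_mul_I c lam (-h.im)
    rw [hh2, mgf_neg, hz] at this
    exact_mod_cast this.symm

end PairIsing

/-! ### 3. Dictionary: the free box as a pair-interaction model on `↥Λ` -/

section Dictionary

variable {V : Type*} [DecidableEq V] (G : SimpleGraph V) [DecidableRel G.Adj] [G.LocallyFinite]

/-- Ordered adjacent pairs versus edges: `∑_{x∈Λ} ∑_{y∈Λ, y∼x} f x y = ∑_{e∈ℰ_Λ} (f x y + f y x)`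
(local copy of the bookkeeping lemma of `TwistCorr.lean` / `MeanFieldDifferentialInequality.lean`,
kept out of this file's imports). [folklore] -/
private theorem sum_adj_eq_sum_edgesIn_loc (Λ : Finset V) (f : V → V → ℝ) :
    ∑ x ∈ Λ, ∑ y ∈ Λ.filter (G.Adj x), f x y =
      ∑ e ∈ edgesIn G Λ, Sym2.lift ⟨fun x y => f x y + f y x, fun _ _ => add_comm _ _⟩ e := by
  set D := (Λ ×ˢ Λ).filter (fun p : V × V => G.Adj p.1 p.2) with hD
  have hL : ∑ x ∈ Λ, ∑ y ∈ Λ.filter (G.Adj x), f x y = ∑ p ∈ D, f p.1 p.2 := by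
    rw [hD, sum_filter, sum_product]
    refine sum_congr rfl fun x _ => ?_
    rw [sum_filter]
  have hmaps : ∀ p ∈ D, s(p.1, p.2) ∈ edgesIn G Λ := by
    intro p hp
    rw [hD, mem_filter, mem_product] at hp
    refine mem_edgesIn_iff.2 ⟨(SimpleGraph.mem_edgeSet G).2 hp.2, fun v hv => ?_⟩
    rcases Sym2.mem_iff.1 hv with rfl | rfl
    · exact hp.1.1
    · exact hp.1.2
  rw [hL, ← sum_fiberwise_of_maps_to hmaps]
  refine sum_congr rfl fun e he => ?_
  induction e using Sym2.ind with
  | _ x y =>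
    obtain ⟨hadj, hmem⟩ := mem_edgesIn_iff.1 he
    have hadj' : G.Adj x y := (SimpleGraph.mem_edgeSet G).1 hadj
    have hxy : x ≠ y := G.ne_of_adj hadj'
    have hfib : D.filter (fun p : V × V => s(p.1, p.2) = s(x, y)) = {(x, y), (y, x)} := by
      ext p
      simp only [hD, mem_filter, mem_product, mem_insert, mem_singleton, Sym2.eq_iff]
      constructor
      · rintro ⟨-, ⟨h1, h2⟩ | ⟨h1, h2⟩⟩
        · left; exact Prod.ext h1 h2
        · right; exact Prod.ext h1 h2
      · rintro (rfl | rfl)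
        · exact ⟨⟨⟨hmem x (Sym2.mem_mk_left x y), hmem y (Sym2.mem_mk_right x y)⟩, hadj'⟩,
            Or.inl ⟨rfl, rfl⟩⟩
        · exact ⟨⟨⟨hmem y (Sym2.mem_mk_right x y), hmem x (Sym2.mem_mk_left x y)⟩, hadj'.symm⟩,
            Or.inr ⟨rfl, rfl⟩⟩
    rw [hfib, sum_pair (fun h => hxy (Prod.ext_iff.1 h).1), Sym2.lift_mk]

/-- The pair-interaction weight with couplings `β/2 · 𝟙{x ∼ y}` on `↥Λ` is the free zero-field Ising
Boltzmann weight `e^{β ∑_{e ∈ ℰ_Λ} σ_e}` (local copy of `PairIsing.weight_adj_eq_isingWeight` of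
`TwistCorr.lean`). [cite: FriedliVelenik2017, §3.1, eqs. (3.2), (3.7)] -/
private theorem weight_adj_eq_isingWeight' (Λ : Finset V) (β : ℝ) (τ : SpinConfig ↥Λ) :
    PairIsing.weight (fun a b : ↥Λ => if G.Adj a b then β / 2 else 0) τ =
      isingWeight G Λ β 0 .free τ := by
  rw [PairIsing.weight, isingWeight]
  congr 1
  simp only [isingHamiltonian, interactionEdges_free, zero_mul, sub_zero, mul_neg, neg_mul, neg_neg]
  set σ : SpinConfig V := glue Λ τ .free with hσ
  have hs : ∀ a : ↥Λ, spinAt a τ = spinAt (a : V) σ := by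
    intro a; simp [spinAt, hσ]
  simp_rw [hs]
  set g : V → V → ℝ := fun x y => (if G.Adj x y then β / 2 else 0) * (spinAt x σ * spinAt y σ)
    with hg
  calc ∑ a : ↥Λ, ∑ b : ↥Λ, g a b = ∑ a : ↥Λ, ∑ y ∈ Λ, g a y :=
        Finset.sum_congr rfl fun a _ => Finset.sum_coe_sort Λ (g a)
    _ = ∑ x ∈ Λ, ∑ y ∈ Λ, g x y := Finset.sum_coe_sort Λ (fun x => ∑ y ∈ Λ, g x y)
    _ = ∑ x ∈ Λ, ∑ y ∈ Λ.filter (G.Adj x), β / 2 * (spinAt x σ * spinAt y σ) := by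
        refine Finset.sum_congr rfl fun x _ => ?_
        rw [Finset.sum_filter]
        refine Finset.sum_congr rfl fun y _ => ?_
        simp only [hg]
        split_ifs <;> simp
    _ = ∑ e ∈ edgesIn G Λ, β * bondSpin σ e := by
        rw [sum_adj_eq_sum_edgesIn_loc G Λ]
        refine Finset.sum_congr rfl fun e _ => ?_
        induction e using Sym2.ind with
        | _ x y => rw [Sym2.lift_mk, bondSpin_mk]; ring
    _ = β * ∑ e ∈ edgesIn G Λ, bondSpin σ e := (Finset.mul_sum _ _ _).symm

/-- `PairIsing.avg` with couplings `β/2 · 𝟙{x ∼ y}` on `↥Λ` is the free-boundary, zero-field Ising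
expectation `⟨f⟩^∅_{Λ;β,0}` of the tree (observables of the spins in `Λ` read through
`σ ↦ σ|_Λ`; local copy of `PairIsing.avg_adj_eq_isingExpect_free` of `TwistCorr.lean`).
[cite: FriedliVelenik2017, §3.1, eq. (3.8)] -/
private theorem avg_adj_eq_isingExpect_free' (Λ : Finset V) (β : ℝ) (f : SpinConfig ↥Λ → ℝ) :
    PairIsing.avg (fun a b : ↥Λ => if G.Adj a b then β / 2 else 0) f =
      isingExpect G Λ β 0 .free (fun σ => f (fun a => σ a)) := by
  have hF : Measurable (fun σ : SpinConfig V => f (fun a : ↥Λ => σ a)) :=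
    (measurable_of_finite f).comp (measurable_pi_lambda _ fun a => measurable_pi_apply _)
  rw [PairIsing.avg, isingExpect, integral_isingMeasure G Λ β 0 .free hF, isingPartitionFunction]
  have hglue : ∀ τ : SpinConfig ↥Λ, (fun a : ↥Λ => glue Λ τ .free a) = τ := fun τ =>
    funext fun a => by simp
  simp_rw [hglue, weight_adj_eq_isingWeight' G Λ β, mul_comm (f _)]

/-- `⟨cos(t ∑_{u∈B} λ_uσ_u)⟩^{free}_{Λ;β,0}` is the `PairIsing` average, with couplings
`β/2·𝟙{a ∼ b}` on `↥Λ`, of `cos(tX)` for the weights `λ𝟙_B` restricted to `Λ` (`B ⊆ Λ`).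
[cite: FriedliVelenik2017, §3.1, eq. (3.8)] -/
theorem isingExpect_cos_eq_avg {Λ B : Finset V} (hBΛ : B ⊆ Λ) (lam : V → ℝ) (β t : ℝ) :
    isingExpect G Λ β 0 .free (fun σ => Real.cos (t * ∑ u ∈ B, lam u * spinAt u σ)) =
      PairIsing.avg (fun a b : ↥Λ => if G.Adj a b then β / 2 else 0)
        (fun τ => Real.cos (t * PairIsing.weightedMagnetization
          (fun a : ↥Λ => if (a : V) ∈ B then lam a else 0) τ)) := by
  rw [avg_adj_eq_isingExpect_free']
  congr 1
  funext σ
  congr 2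
  unfold PairIsing.weightedMagnetization
  have hspin : ∀ a : ↥Λ, spinAt a (fun a : ↥Λ => σ a) = spinAt (a : V) σ := fun a => rfl
  simp_rw [hspin]
  have hsum : ∑ a : ↥Λ, (if (a : V) ∈ B then lam a else 0) * spinAt (a : V) σ =
      ∑ x ∈ Λ, (if x ∈ B then lam x else 0) * spinAt x σ :=
    Finset.sum_coe_sort Λ (fun x => (if x ∈ B then lam x else 0) * spinAt x σ)
  rw [hsum]
  simp_rw [ite_mul, zero_mul]
  rw [Finset.sum_ite_mem, Finset.inter_eq_right.2 hBΛ]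

end Dictionary

/-! ### 4. Assembly -/

namespace CamiaJiangNewman

/-- **CJN 2023 Thm 2 (zero form) ⇒ `firstZero_antitone`.** For `0 ≤ β ≤ β'`, weights `λ ≥ 0`
on `B ⊆ Λ` and a zero `θ > 0` of `⟨cos(θ∑_{u∈B}λ_uσ_u)⟩^{free}_{Λ;β,0}`, there is a zero
`θ' ∈ (0, θ]` of `⟨cos(θ'∑_{u∈B}λ_uσ_u)⟩^{free}_{Λ;β',0}`: the zero `iθ` of the `β`-mgf yields
(Thm 2) a zero `h'` of the `β'`-mgf with `‖h'‖ ≤ θ`, purely imaginary by Lee–Yang.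
[cite: CamiaJiangNewman2023, Thm 2, Cor 1 and proof of Thm 2 (§1.2, p. 4)] -/
theorem firstZero_antitone_of_thm2 (h2 : CamiaJiangNewman2023_thm2) : firstZero_antitone := by
  intro V _ G _ Λ B hBΛ lam hlam β β' θ hβ hββ' hθ hzero
  classical
  -- couplings `β/2·𝟙{a ∼ b} ≤ β'/2·𝟙{a ∼ b}` and weights `λ𝟙_B ≥ 0` on `↥Λ`
  have hc : ∀ a b : ↥Λ, 0 ≤ (if G.Adj a b then β / 2 else (0 : ℝ)) := fun a b => by
    split_ifs <;> linarith
  have hcc' : ∀ a b : ↥Λ, (if G.Adj a b then β / 2 else (0 : ℝ)) ≤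
      (if G.Adj a b then β' / 2 else (0 : ℝ)) := fun a b => by
    split_ifs <;> linarith
  have hc' : ∀ a b : ↥Λ, 0 ≤ (if G.Adj a b then β' / 2 else (0 : ℝ)) :=
    fun a b => (hc a b).trans (hcc' a b)
  have hlam' : ∀ a : ↥Λ, 0 ≤ (if (a : V) ∈ B then lam a else (0 : ℝ)) := fun a => by
    split_ifs with ha
    · exact hlam a ha
    · exact le_rfl
  -- the zero `iθ` of the `β`-mgf
  have hz : PairIsing.mgf (fun a b : ↥Λ => if G.Adj a b then β / 2 else 0)
      (fun a : ↥Λ => if (a : V) ∈ B then lam a else 0) (θ * I) = 0 := by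
    rw [PairIsing.mgf_mul_I, ← isingExpect_cos_eq_avg G hBΛ lam β θ, hzero, ofReal_zero]
  -- CJN Thm 2 (zero form): a zero of the `β'`-mgf of modulus `≤ θ`
  obtain ⟨h', hh', hnorm⟩ := h2 (↥Λ) (fun a b : ↥Λ => if G.Adj a b then β / 2 else 0)
    (fun a b : ↥Λ => if G.Adj a b then β' / 2 else 0)
    (fun a : ↥Λ => if (a : V) ∈ B then lam a else 0) hc hcc' hlam' (θ * I) hz
  -- Lee–Yang: it is `±iθ'` with `θ'` a real zero of `⟨cos θ'X⟩_{β'}`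
  obtain ⟨θ', hθ'pos, hθ'le, hcos⟩ :=
    PairIsing.exists_cos_zero_of_mgf_eq_zero (c := fun a b : ↥Λ => if G.Adj a b then β' / 2 else 0)
      (lam := fun a : ↥Λ => if (a : V) ∈ B then lam a else 0) hc' hlam' hh'
  refine ⟨θ', hθ'pos, ?_, ?_⟩
  · calc θ' ≤ ‖h'‖ := hθ'le
      _ ≤ ‖(θ : ℂ) * I‖ := hnorm
      _ = θ := by simp [abs_of_pos hθ]
  · rw [isingExpect_cos_eq_avg G hBΛ lam β' θ']
    exact hcos

end CamiaJiangNewman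

end Literature.Probability.LatticeModels
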